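import Literature.MathematicalPhysics.QuantumFieldTheory.Balaban1983to89.B9

/-!
# `Balaban1983to89.B9SectBStepFamilyTransferPos` — the Sect.-B step `B9.SectBStepPrinted` transfers between two readings when the INPUT domination
# is known only at POSITIVE rates: the arbitrary input tuple of the printed leaf is by-passed through «Theorems 3.1–3.3 hold at the base» (p. 407)

T. Bałaban, *Propagators for lattice gauge theories in a background field*, Commun. Math. Phys. **99** (1985) 389–434
[`Balaban1985BackgroundPropagators`, "B9"], Theorem 3.4 p. 400, Sect. B pp. 400–407, p. 407 («Thus Theorem 3.4 is proved, assuming that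
Theorems 3.1–3.3 hold»).

statement-level skeleton of published theorems with citation tags; proofs where landed; nothing here is a claim about the
Yang–Mills mass gap

WHY THIS FILE (pub-ymgap N06 row 13, seat dag-n06-c gen 9).  `B9SectBStepFamilyTransfer.sectBStepPrinted_of_family` asks the input domination `hin`
for input constants OF ANY SIGN, because the printed leaf `B9.SectBStepPrinted` quantifies over an arbitrary input tuple.  A domination that runs
Lemma 2.1 of [4] (the `L²` member of the (O4) per-member programme: `B9SectBCodedChainL2.hin_KSC₃_on_pos`) exists only at positive rates.  The
tree's own way around the arbitrary tuple is `B9SectBStepWhole.sectBStepPrinted_of_posSteps`: the step is APPLIED AT THE POSITIVE CONSTANTS of the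
theorems that hold at the base, the given tuple being by-passed.  This file is that by-pass for the family transfer: GIVEN that the target reading's
Theorem-3.1–3.3 blocks hold at every (3.35)-regular base with SOME positive constants (a displayed hypothesis — print's standing assumption of Sect. B,
p. 407), the input domination is used once, at those constants.  Quantifier bookkeeping only.
Value = bookkeeping; NOT summit progress; N06 is not discharged by this file.
-/

namespace Literature.MathematicalPhysics.QuantumFieldTheory.Balaban1983to89.B9SectBStepFamilyTransferPos

open Literature.MathematicalPhysics.QuantumFieldTheory.Balaban1983to89.B9 (Backgrounds Geometry KernelFamily SiteKernel Thms31to33IneqAt SectBStepPrinted)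

variable {I : Type} (d : ℕ) (c35 : ℝ) (geo : I → Geometry) (bg : I → Backgrounds)
  (Gp₁ Gp₂ GA₁ GA₂ : ∀ i, KernelFamily (geo i) (bg i)) (Cinv : ∀ i, SiteKernel (geo i) (bg i))
  (IsAn₁ IsAn₂ : ∀ i, KernelFamily (geo i) (bg i) → (bg i).Cfg → ℝ → Prop)

/-- ★ **THE SECT.-B STEP TRANSFERS BETWEEN MUTUALLY DOMINATING READINGS, INPUT DOMINATION AT POSITIVE RATES** («of course with different
constants», p. 403; «assuming that Theorems 3.1–3.3 hold», p. 407).  As `B9SectBStepFamilyTransfer.sectBStepPrinted_of_family`, except that the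
input domination `hin` (blocks of `(Gp₂, GA₂, Cinv)` at a regular base ⟹ blocks of `(Gp₁, GA₁, Cinv)`) is required only for input rates `δ₀ > 0`, and the
Theorem-3.1–3.3 blocks of `(Gp₂, GA₂, Cinv)` at every (3.35)-regular base above a threshold are GIVEN with some constants, the rate positive (`hThms`):
the printed leaf's arbitrary input tuple is not used — the step of the first reading is applied at the given positive constants.
[cite: Balaban1985BackgroundPropagators, Thm 3.4 p.400, p.403 l.1–9, p.407, (3.35)–(3.37) p.396] -/
theorem sectBStepPrinted_of_family_pos
    (hThms : ∃ (Mt aT B₀ δ₀ : ℝ) (Bβ Bε : ℝ → ℝ) (Bεβ : ℝ → ℝ → ℝ) (B₁ δ₁ : ℝ), 0 < aT ∧ 0 < δ₀ ∧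
      ∀ i : I, Mt ≤ (geo i).M → ∀ α₀ : ℝ, 0 < α₀ → (geo i).M * α₀ ≤ aT → ∀ U : (bg i).Cfg, (bg i).Reg335 c35 α₀ U →
        Thms31to33IneqAt d (Gp₂ i) (GA₂ i) (Cinv i) B₀ δ₀ Bβ Bε Bεβ B₁ δ₁ U)
    (hin : ∀ (B₀ δ₀ : ℝ) (Bβ Bε : ℝ → ℝ) (Bεβ : ℝ → ℝ → ℝ) (B₁ δ₁ : ℝ), 0 < δ₀ →
      ∃ (Mi ai B₀' δ₀' : ℝ) (Bβ' Bε' : ℝ → ℝ) (Bεβ' : ℝ → ℝ → ℝ) (B₁' δ₁' : ℝ), 0 < ai ∧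
        ∀ i : I, Mi ≤ (geo i).M → ∀ α₀ : ℝ, 0 < α₀ → (geo i).M * α₀ ≤ ai → ∀ U : (bg i).Cfg, (bg i).Reg335 c35 α₀ U →
          Thms31to33IneqAt d (Gp₂ i) (GA₂ i) (Cinv i) B₀ δ₀ Bβ Bε Bεβ B₁ δ₁ U →
          Thms31to33IneqAt d (Gp₁ i) (GA₁ i) (Cinv i) B₀' δ₀' Bβ' Bε' Bεβ' B₁' δ₁' U)
    (hout : ∀ (B₀ δ₀ : ℝ) (Bβ Bε : ℝ → ℝ) (Bεβ : ℝ → ℝ → ℝ) (B₁ δ₁ : ℝ) (a : ℝ), 0 < B₀ → 0 < δ₀ → 0 < B₁ → 0 < δ₁ → 0 < a →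
      ∃ (Mo ao a' B₀' δ₀' : ℝ) (Bβ' Bε' : ℝ → ℝ) (Bεβ' : ℝ → ℝ → ℝ) (B₁' δ₁' : ℝ), 0 < ao ∧ 0 < a' ∧ a' ≤ a ∧ 0 < B₀' ∧ 0 < δ₀' ∧ 0 < B₁' ∧ 0 < δ₁' ∧
        ∀ i : I, Mo ≤ (geo i).M → ∀ α₀ : ℝ, 0 < α₀ → (geo i).M * α₀ ≤ ao → ∀ U : (bg i).Cfg, (bg i).Reg335 c35 α₀ U →
          ∀ α₁ : ℝ, 0 < α₁ → α₁ ≤ a' → ∀ U' : (bg i).Cfg, (bg i).Cplx337 α₁ U U' →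
          Thms31to33IneqAt d (Gp₁ i) (GA₁ i) (Cinv i) B₀ δ₀ Bβ Bε Bεβ B₁ δ₁ ((bg i).mul U' U) →
          Thms31to33IneqAt d (Gp₂ i) (GA₂ i) (Cinv i) B₀' δ₀' Bβ' Bε' Bεβ' B₁' δ₁' ((bg i).mul U' U))
    (hAn : ∀ i (U : (bg i).Cfg) (α : ℝ), (IsAn₁ i (Gp₁ i) U α → IsAn₂ i (Gp₂ i) U α) ∧ (IsAn₁ i (GA₁ i) U α → IsAn₂ i (GA₂ i) U α))
    (h : SectBStepPrinted d c35 geo bg Gp₁ GA₁ Cinv IsAn₁) :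
    SectBStepPrinted d c35 geo bg Gp₂ GA₂ Cinv IsAn₂ := by
  intro _ _ _ _ _ _ _
  obtain ⟨Mt, aT, Bt, δt, Bβt, Bεt, Bεβt, B₁t, δ₁t, hat, hδt, HT⟩ := hThms
  obtain ⟨Mi, ai, B₀i, δ₀i, Bβi, Bεi, Bεβi, B₁i, δ₁i, hai, Hin⟩ := hin Bt δt Bβt Bεt Bεβt B₁t δ₁t hδt
  obtain ⟨M₀, a₁, a₀', B₀', δ₀', Bβ', Bε', Bεβ', B₁', δ₁', hM₀, ha₁, ha₀', hB₀', hδ₀', hB₁', hδ₁', H⟩ := h B₀i δ₀i Bβi Bεi Bεβi B₁i δ₁i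
  obtain ⟨Mo, ao, a', B₀o, δ₀o, Bβo, Bεo, Bεβo, B₁o, δ₁o, hao, ha', ha'a, hB₀o, hδ₀o, hB₁o, hδ₁o, Hout⟩ :=
    hout B₀' δ₀' Bβ' Bε' Bεβ' B₁' δ₁' a₁ hB₀' hδ₀' hB₁' hδ₁' ha₁
  refine ⟨max M₀ (max Mi (max Mo Mt)), a', min a₀' (min ai (min ao aT)), B₀o, δ₀o, Bβo, Bεo, Bεβo, B₁o, δ₁o,
    lt_max_of_lt_left hM₀, ha', lt_min ha₀' (lt_min hai (lt_min hao hat)), hB₀o, hδ₀o, hB₁o, hδ₁o, fun i hM α₀ hα₀ hMa U hU _ α₁ hα₁ hα₁a => ?_⟩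
  have hM0 : M₀ ≤ (geo i).M := le_trans (le_max_left _ _) hM
  have hMi : Mi ≤ (geo i).M := le_trans (le_trans (le_max_left _ _) (le_max_right _ _)) hM
  have hMo : Mo ≤ (geo i).M := le_trans (le_trans (le_trans (le_max_left _ _) (le_max_right _ _)) (le_max_right _ _)) hM
  have hMt : Mt ≤ (geo i).M := le_trans (le_trans (le_trans (le_max_right _ _) (le_max_right _ _)) (le_max_right _ _)) hM
  have ha0 : (geo i).M * α₀ ≤ a₀' := le_trans hMa (min_le_left _ _)
  have hai' : (geo i).M * α₀ ≤ ai := le_trans hMa (le_trans (min_le_right _ _) (min_le_left _ _))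
  have hao' : (geo i).M * α₀ ≤ ao := le_trans hMa (le_trans (min_le_right _ _) (le_trans (min_le_right _ _) (min_le_left _ _)))
  have hat' : (geo i).M * α₀ ≤ aT := le_trans hMa (le_trans (min_le_right _ _) (le_trans (min_le_right _ _) (min_le_right _ _)))
  -- the by-pass: the given Theorem-3.1–3.3 blocks at the base, at their positive constants
  have hT₂ := HT i hMt α₀ hα₀ hat' U hU
  have hT₁ := Hin i hMi α₀ hα₀ hai' U hU hT₂
  obtain ⟨hAp, hAA, Hprod⟩ := H i hM0 α₀ hα₀ ha0 U hU hT₁ α₁ hα₁ (le_trans hα₁a ha'a)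
  refine ⟨(hAn i U α₁).1 hAp, (hAn i U α₁).2 hAA, fun U' hU' => ?_⟩
  exact Hout i hMo α₀ hα₀ hao' U hU α₁ hα₁ hα₁a U' hU' (Hprod U' hU')

end Literature.MathematicalPhysics.QuantumFieldTheory.Balaban1983to89.B9SectBStepFamilyTransferPos
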